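import Summits.ResolutionOfSingularities.ResolutionOfSingularities.Theorems.HistoryTransport
import HarnessLib

/-!
# HistoryTransport2 — decomp-res node «HistoryCut» (lens-4 g29, critic row 169), tree file 2/4 of the node

Content VERBATIM from the decomp-res lens-4 g29 node `HOME/decomp-res-lens-4/g29/HistoryCut.lean` (pin aaa5a818),
NEW PART §78–§80 = `parts/part_new-g29-0eb23edf.lean`;
HOME = run/shared/lean/pub/decomp-res; critic row 169 CLEARED +1; landing orders INBOX :708 / :721 — provenance,
critic text and the lens header in full in the
first file of the node, `HistoryTransport`.  Namespace `…Theorems.HugValuationCut`; `--supports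
stmt-ResolutionOfSingularities-28338`.

## This file

Continuation 2/2 of `HistoryTransport` (same section of the node, cut at the 400-line cap): carries
`point_round_chart_rsop₂`, `eTail_strict_transport`.

[WRITER NOTE (decomp-res writer g10): file split only (tree files ≤ 400 lines); namespace, universes, sections,
section variables and every declaration
exactly as in the lens (the node's global dupNamespace-linter line is dropped — the library sets it; the `open
…Theses` line lives only in the wiring file;
`set_option maxHeartbeats … in` prefixes of single declarations are kept).]

(Sources: Hauser2010Kangaroo (arXiv:0811.4151 p. 6, Kangaroo Theorem condition (3) + remark (a)); HauserPerlega2019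
§2; Hauser2024 PRIMS 60; Moh1987; Matsumura1987 Thms. 14.2–14.3; ZariskiSamuel1960 VIII §11; StacksProject Tags
0804, 0BIQ, 00NQ; DeJong1996 2.4; CossartPiltant2008 §2; Giraud1975.)
-/

noncomputable section

open CategoryTheory AlgebraicGeometry IsLocalRing
open Literature.AlgebraicGeometry.Resolution
open Summit.ResolutionOfSingularities.ResolutionOfSingularities.Theorems
open WeakOrderReduction ForcedTowerClasses DivergentTowerClasses MonomialTowerClasses
open HugDimensionClasses HugDimensionKernels SurfaceShadowClasses SurfaceShadowKernels
open NearPointCut (SingularClass)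
open AbsoluteContactClasses (IsAbsContactAt SepResidueAt diffIdeal_restrict_le stalkMap_comp_toStalk_eq_stalkHom)
open scoped BigOperators

namespace Summit.ResolutionOfSingularities.ResolutionOfSingularities.Theorems.HugValuationCut

section HistoryTransport

universe uT'
variable {X X' : Scheme.{uT'}} {π : X' ⟶ X} {C : X.IdealSheafData}

set_option maxHeartbeats 400000 in
/-- **Point round, chart side, for a REGULAR PAIR `(t, z)` and THREE JOINT LETTERS** (g28's `point_round_chart_rsop` for two
germs in ONE chart): `E_x = (t)`, `H_x = (z)`, `(t, z)` part of a regular system of `𝒪_x`; then for the exceptional generator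
`s = π^*c_i` of the Rees chart, `π^*t = s·t₁`, `π^*z = s·z'`, the weak transforms are `(t₁)`, `(z')`, and IF `t₁, z' ∈ 𝔪_y` then
`(s, t₁, z')` IS PART OF ONE REGULAR SYSTEM OF PARAMETERS of `𝒪_{X',y}`.
(Sources: StacksProject, Tags 0804, 0BIQ; Matsumura1987, Thm. 14.2; DeJong1996, 2.4.) -/
theorem point_round_chart_rsop₂ (hπ : IsBlowup π C) (y : X') [IsRegularLocalRing (X.presheaf.stalk (π y))]
    (hC : stalkIdeal C (π y) = maximalIdeal (X.presheaf.stalk (π y)))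
    {t z : X.presheaf.stalk (π y)} (htz : IsRsopPart ![t, z]) {E H : X.IdealSheafData}
    (hEt : stalkIdeal E (π y) = Ideal.span {t}) (hHz : stalkIdeal H (π y) = Ideal.span {z}) :
    ∃ (𝔷 : X.presheaf.stalk (π y)) (t₁ z' : X'.presheaf.stalk y),
      stalkIdeal (C.comap π) y = Ideal.span {(π.stalkMap y).hom 𝔷} ∧
      (π.stalkMap y).hom 𝔷 ∈ nonZeroDivisors (X'.presheaf.stalk y) ∧
      (π.stalkMap y).hom t = (π.stalkMap y).hom 𝔷 * t₁ ∧
      (π.stalkMap y).hom z = (π.stalkMap y).hom 𝔷 * z' ∧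
      stalkIdeal (controlledTransform π C E 1) y = Ideal.span {t₁} ∧
      stalkIdeal (controlledTransform π C H 1) y = Ideal.span {z'} ∧
      (t₁ ∈ maximalIdeal (X'.presheaf.stalk y) → z' ∈ maximalIdeal (X'.presheaf.stalk y) →
        IsRsopPart ![(π.stalkMap y).hom 𝔷, t₁, z']) := by
  classical
  obtain ⟨e, c, hd, hc, hc0⟩ := htz.exists_rsop
  obtain ⟨jt, hjt⟩ : ∃ jt : Fin (2 + e), jt = Fin.castAdd e 0 := ⟨_, rfl⟩
  obtain ⟨jz, hjz⟩ : ∃ jz : Fin (2 + e), jz = Fin.castAdd e 1 := ⟨_, rfl⟩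
  have hcjt : c jt = t := by rw [hjt, hc0]; rfl
  have hcjz : c jz = z := by rw [hjz, hc0]; rfl
  have hne : jt ≠ jz := by
    rw [hjt, hjz]
    exact fun h' => absurd (Fin.castAdd_injective 2 e h') (by decide)
  have hcC : Ideal.span (Set.range c) = stalkIdeal C (π y) := hc.trans hC.symm
  have hTE : Ideal.span (c '' {jt}) = stalkIdeal E (π y) := by rw [Set.image_singleton, hcjt, hEt]
  have hTH : Ideal.span (c '' {jz}) = stalkIdeal H (π y) := by rw [Set.image_singleton, hcjz, hHz]
  obtain ⟨i, 𝔴, χ, hχ, hloc, h𝔴⟩ := hπ.exists_reesChart_stalk y c hcC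
  obtain ⟨hEx, hE'⟩ := hπ.stalkIdeal_controlledTransform_eq_span_chartGen y c hcC {jt} hTE i 𝔴 χ hχ hloc
  obtain ⟨-, hH'⟩ := hπ.stalkIdeal_controlledTransform_eq_span_chartGen y c hcC {jz} hTH i 𝔴 χ hχ hloc
  letI alg : Algebra (chartRing c i) (X'.presheaf.stalk y) := χ.toAlgebra
  haveI : IsLocalization.AtPrime (X'.presheaf.stalk y) 𝔴.asIdeal := hloc
  have halg : ∀ b, algebraMap (chartRing c i) (X'.presheaf.stalk y) b = χ b := fun b => by
    rw [RingHom.algebraMap_toAlgebra]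
  refine ⟨c i, χ (chartGen c i jt), χ (chartGen c i jz), ?_, ?_, ?_, ?_, ?_, ?_, ?_⟩
  · rw [hEx, hχ]
  · rw [← hχ, ← halg]
    exact IsLocalization.nonZeroDivisors_le_comap 𝔴.asIdeal.primeCompl _
      (reesChartBase_mem_nonZeroDivisors _ _)
  · rw [← hcjt, ← hχ, ← hχ, reesChartBase_apply_eq_mul_chartGen c i jt, map_mul]
  · rw [← hcjz, ← hχ, ← hχ, reesChartBase_apply_eq_mul_chartGen c i jz, map_mul]
  · rw [hE', Set.image_singleton]
  · rw [hH', Set.image_singleton]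
  · intro ht₁m hz'm
    have hmem : ∀ j, χ (chartGen c i j) ∈ maximalIdeal (X'.presheaf.stalk y) → chartGen c i j ∈ 𝔴.asIdeal := by
      intro j hj
      rw [← halg] at hj
      exact (IsLocalization.AtPrime.to_map_mem_maximal_iff (X'.presheaf.stalk y) 𝔴.asIdeal _).mp hj
    have hnei : ∀ j, chartGen c i j ∈ 𝔴.asIdeal → j ≠ i := by
      intro j hj h
      have h1 : chartGen c i j = 1 := by rw [h]; exact chartGen_self c i
      rw [h1] at hj
      exact 𝔴.isPrime.ne_top ((Ideal.eq_top_iff_one _).mpr hj)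
    have hjt𝔴 := hmem jt ht₁m
    have hjz𝔴 := hmem jz hz'm
    -- empty complementary family
    let w : Fin 0 → X.presheaf.stalk (π y) := fun k => k.elim0
    have hrange : Set.range (Fin.append c w) = Set.range c := by
      ext a
      constructor
      · rintro ⟨m, rfl⟩
        refine Fin.addCases (fun j => ?_) (fun k => k.elim0) m
        exact ⟨j, by rw [Fin.append_left]⟩
      · rintro ⟨j, rfl⟩
        exact ⟨Fin.castAdd 0 j, by rw [Fin.append_left]⟩
    have hzw : Ideal.span (Set.range (Fin.append c w)) = maximalIdeal _ := by rw [hrange, hc]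
    have hd' : (maximalIdeal (X.presheaf.stalk (π y))).spanFinrank = (2 + e) + 0 := by
      rw [hd, Nat.add_zero]
    let jJ : Fin 2 → {j : Fin (2 + e) // j ≠ i} := ![⟨jt, hnei jt hjt𝔴⟩, ⟨jz, hnei jz hjz𝔴⟩]
    have hjJ0 : (jJ 0).1 = jt := rfl
    have hjJ1 : (jJ 1).1 = jz := rfl
    have hjJ : Function.Injective jJ := by
      intro a b hab
      have hab' := congrArg Subtype.val hab
      fin_cases a <;> fin_cases b
      · rfl
      · exact absurd (hjJ0.symm.trans (hab'.trans hjJ1)) hne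
      · exact absurd (hjJ0.symm.trans (hab'.symm.trans hjJ1)) hne
      · rfl
    haveI : 𝔴.asIdeal.IsPrime := 𝔴.isPrime
    have hJ : ∀ k', chartGen c i (jJ k').1 ∈ 𝔴.asIdeal := by
      intro k'
      fin_cases k'
      · exact hjt𝔴
      · exact hjz𝔴
    have hR := isRsopPart_chartFamily_reesChart c i w hzw hd' 𝔴.asIdeal h𝔴 (X'.presheaf.stalk y) jJ hjJ hJ
    have h0 : chartFamily c i w (X'.presheaf.stalk y) (chartBase c i) (chartGen c i) jJ 0 = (π.stalkMap y).hom (c i) := by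
      rw [← hχ (c i), ← halg]
      simp only [chartFamily, Fin.cons_zero]
    have h1 : chartFamily c i w (X'.presheaf.stalk y) (chartBase c i) (chartGen c i) jJ (Fin.succ (Fin.castAdd 0 0)) =
        χ (chartGen c i jt) := by
      rw [← halg, ← hjJ0]
      simp only [chartFamily, Fin.cons_succ, Fin.append_left]
    have h2 : chartFamily c i w (X'.presheaf.stalk y) (chartBase c i) (chartGen c i) jJ (Fin.succ (Fin.castAdd 0 1)) =
        χ (chartGen c i jz) := by
      rw [← halg, ← hjJ1]
      simp only [chartFamily, Fin.cons_succ, Fin.append_left]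
    refine isRsopPart_of_range_eq hR rfl ?_
    have hv0 : (![(π.stalkMap y).hom (c i), χ (chartGen c i jt), χ (chartGen c i jz)] : Fin 3 → X'.presheaf.stalk y) 0 =
        (π.stalkMap y).hom (c i) := rfl
    have hv1 : (![(π.stalkMap y).hom (c i), χ (chartGen c i jt), χ (chartGen c i jz)] : Fin 3 → X'.presheaf.stalk y) 1 =
        χ (chartGen c i jt) := rfl
    have hv2 : (![(π.stalkMap y).hom (c i), χ (chartGen c i jt), χ (chartGen c i jz)] : Fin 3 → X'.presheaf.stalk y) 2 =
        χ (chartGen c i jz) := rfl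
    apply Set.Subset.antisymm
    · rintro _ ⟨a, rfl⟩
      fin_cases a
      · exact ⟨0, h0.trans hv0.symm⟩
      · exact ⟨Fin.succ (Fin.castAdd 0 0), h1.trans hv1.symm⟩
      · exact ⟨Fin.succ (Fin.castAdd 0 1), h2.trans hv2.symm⟩
    · rintro _ ⟨a, rfl⟩
      have ha : a = 0 ∨ a = Fin.succ (Fin.castAdd 0 0) ∨ a = Fin.succ (Fin.castAdd 0 1) := by
        obtain ⟨v, hv⟩ := a
        have h3 : v = 0 ∨ v = 1 ∨ v = 2 := by omega
        rcases h3 with rfl | rfl | rfl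
        · exact Or.inl rfl
        · exact Or.inr (Or.inl (Fin.ext rfl))
        · exact Or.inr (Or.inr (Fin.ext rfl))
      rcases ha with rfl | rfl | rfl
      · exact ⟨0, hv0.trans h0.symm⟩
      · exact ⟨1, hv1.trans h1.symm⟩
      · exact ⟨2, hv2.trans h2.symm⟩

/-- **S3 — THE STRICT TRANSPORT OF THE MEMORY (KERNEL, PROVED), one point blow-up.**  `π` the blowing up of the regular
locally Noetherian `X` in the closed point `x = π y`, `𝓘_x ⊆ 𝔪_x^n`, `𝓘' = (π^{-1}𝓘 : E_new^n)` with `𝓘'_y ⊆ 𝔪_y^n`,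
`PWInv 𝓘 H n x`
(the stage is PRINCIPAL) and `ETail 𝓘 H E n x` (the tail is divisible by the OLD component `E = (t)`).  IF there is NO JUMP at
`y` (`WInv 𝓘' H' n y`) AND `y` LIES ON THE STRICT TRANSFORM `E'` OF `E` (a satellite move with respect to `E`), THEN
`ETail 𝓘' H' E' n y`: the memory of `E` is transported.  PROOF: joint chart (`point_round_chart_rsop₂`): `π^*t = s t₁`,
`π^*z = s z'`, `E'_y = (t₁)`, `H'_y = (z')`, `(s, t₁, z')` part of one regular system (`t₁ ∈ 𝔪_y` = satellite, `z' ∈ 𝔪_y` = the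
order did not drop); tail `w₀ − π^*c·z'^n = s·t₁·g₁`; the no-jump witness `f₁ = e·w₀ + k₂·s^n` (transported principality) has
`e` a unit and `e·π^*c ≡ c₁ (mod 𝔪)` (LEMMA Z on `(s, z')`), and `k₂ ∈ 𝔪` (LEMMA Z₃: `k₂ s^n ∈ (t₁, z') + 𝔪^{n+1}`); so
`s·t₁·g₁ = e⁻¹[(f₁ − c₁z'^n) − (eπ^*c − c₁)z'^n − k₂s^n] ∈ 𝔪^{n+1} ∩ (t₁)`.
(Sources: Hauser2010Kangaroo; EncinasVillamayor2000, Thm. 4.9; StacksProject, Tag 0BIQ; Matsumura1987, Thm. 14.3.) -/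
theorem eTail_strict_transport (hπ : IsBlowup π C) [IsLocallyNoetherian X] [IsLocallyNoetherian X']
    (hX : Scheme.IsRegular X) (hCreg : Scheme.IsRegular C.subscheme) (I H E : X.IdealSheafData) {n : ℕ} (hn : 1 ≤ n)
    (y : X') (hcl : IsClosed ({π y} : Set X)) (hpt : (C.support : Set X) = {π y})
    (hIn : stalkIdeal I (π y) ≤ maximalIdeal _ ^ n)
    (hI'n : stalkIdeal (controlledTransform π C I n) y ≤ maximalIdeal _ ^ n)
    (hP : PWInv I H n (π y)) (h : ETail I H E n (π y))
    (h' : WInv (controlledTransform π C I n) (strictTransformIdeal π C H) n y)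
    (hsat : y ∈ (strictTransformIdeal π C E).support) :
    ETail (controlledTransform π C I n) (strictTransformIdeal π C H) (strictTransformIdeal π C E) n y := by
  obtain ⟨z, t, hHz, hEt, hrs0, f, hfI, hpr, c, hc, hft, hfm⟩ := exists_principal_eTail hn hP h
  haveI : IsRegularLocalRing (X.presheaf.stalk (π y)) := hX _
  have ht2 : t ∉ maximalIdeal _ ^ 2 := by simpa using hrs0.not_mem_sq 0
  have hCst : stalkIdeal C (π y) = maximalIdeal _ := by
    rw [eq_vanishingIdeal_support_of_isRegular C hCreg]
    apply stalkIdeal_vanishingIdeal_eq_maximalIdeal_of_closure_eq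
    rw [hpt, hcl.closure_eq]
  obtain ⟨𝔷, t₁, z', hE, hnzd, htt, hzz', -, -, hreg⟩ := point_round_chart_rsop₂ hπ y hCst hrs0 hEt hHz
  set σ := (π.stalkMap y).hom with hσ
  set s := σ 𝔷 with hs
  have hEm : (maximalIdeal (X.presheaf.stalk (π y))).map σ = Ideal.span {s} := by
    rw [← hCst, ← stalkIdeal_comap_eq_map_stalkMap, hE]
  have hmle : (maximalIdeal (X.presheaf.stalk (π y))).map σ ≤ maximalIdeal (X'.presheaf.stalk y) :=
    Ideal.map_le_iff_le_comap.mpr fun a ha => Ideal.mem_comap.mpr (map_nonunit σ a ha)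
  have hsm : s ∈ maximalIdeal (X'.presheaf.stalk y) := hmle (by rw [hEm]; exact Ideal.mem_span_singleton_self s)
  -- `π^* f = w₀ · s^n` with `w₀ ∈ 𝓘'_y`
  have hσf : σ f ∈ Ideal.span {s ^ n} := by
    have hm : σ f ∈ (maximalIdeal _ ^ n).map σ := Ideal.mem_map_of_mem _ (hIn hfI)
    rwa [Ideal.map_pow, hEm, Ideal.span_singleton_pow] at hm
  obtain ⟨w₀, hw₀⟩ := Ideal.mem_span_singleton'.mp hσf
  have hI' : stalkIdeal (controlledTransform π C I n) y =
      Submodule.colon ((stalkIdeal I (π y)).map σ) {s ^ n} := by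
    rw [hπ.stalkIdeal_controlledTransform I n y, stalkIdeal_comap_eq_map_stalkMap, hE,
      Ideal.span_singleton_pow, Submodule.colon_span]
  have hw₀I' : w₀ ∈ stalkIdeal (controlledTransform π C I n) y := by
    rw [hI', Submodule.mem_colon_singleton, smul_eq_mul, hw₀]
    exact Ideal.mem_map_of_mem _ hfI
  -- the tail `t · g`, `g ∈ 𝔪_x^n`, `π^*g = g₁ s^n`
  obtain ⟨g, hg⟩ := Ideal.mem_span_singleton'.mp hft
  have hgm : g ∈ maximalIdeal _ ^ n := by
    refine mem_pow_of_mul_mem_pow_succ ht2 ?_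
    rw [mul_comm, hg]; exact hfm
  have hσg : σ g ∈ Ideal.span {s ^ n} := by
    have hm : σ g ∈ (maximalIdeal _ ^ n).map σ := Ideal.mem_map_of_mem _ hgm
    rwa [Ideal.map_pow, hEm, Ideal.span_singleton_pow] at hm
  obtain ⟨g₁, hg₁⟩ := Ideal.mem_span_singleton'.mp hσg
  -- cancel `s^n`: the transported tail is `s · t₁ · g₁`
  have hkey : w₀ - σ c * z' ^ n = s * t₁ * g₁ := by
    have h1 : s ^ n * (w₀ - σ c * z' ^ n) = s ^ n * (s * t₁ * g₁) := by
      have e1 : σ (f - c * z ^ n) = σ f - σ c * (s * z') ^ n := by rw [map_sub, map_mul, map_pow, hzz']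
      have e2 : σ (f - c * z ^ n) = σ g * σ t := by rw [← hg, map_mul]
      calc s ^ n * (w₀ - σ c * z' ^ n) = w₀ * s ^ n - σ c * (s * z') ^ n := by ring
        _ = σ (f - c * z ^ n) := by rw [e1, hw₀]
        _ = σ g * σ t := e2
        _ = g₁ * s ^ n * (s * t₁) := by rw [hg₁, htt]
        _ = s ^ n * (s * t₁ * g₁) := by ring
    exact (mul_cancel_left_mem_nonZeroDivisors (pow_mem hnzd n)).mp h1
  -- `z' ∈ 𝔪_y` (the order did not drop)
  have hcu : IsUnit (σ c) := hc.map σ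
  have hI'1 : stalkIdeal (controlledTransform π C I n) y ≤ maximalIdeal _ :=
    hI'n.trans (Ideal.pow_le_self (by omega))
  have hz'p : σ c * z' ^ n ∈ maximalIdeal (X'.presheaf.stalk y) := by
    have h1 : w₀ - s * t₁ * g₁ ∈ maximalIdeal _ :=
      sub_mem (hI'1 hw₀I') (Ideal.mul_mem_right _ _ (Ideal.mul_mem_right _ _ hsm))
    have e : w₀ - s * t₁ * g₁ = σ c * z' ^ n := by rw [← hkey]; ring
    rwa [e] at h1
  have hz'm : z' ∈ maximalIdeal (X'.presheaf.stalk y) :=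
    Ideal.IsPrime.mem_of_pow_mem inferInstance n ((Ideal.unit_mul_mem_iff_mem _ hcu).mp hz'p)
  -- SATELLITE with respect to `E`: `t₁ ∈ 𝔪_y`
  have ht₁m : t₁ ∈ maximalIdeal (X'.presheaf.stalk y) := by
    have h1 : t₁ ∈ stalkIdeal (strictTransformIdeal π C E) y :=
      quotient_mem_stalk_strictTransform E y (by rw [hEt]; exact Ideal.mem_span_singleton_self t) hE htt
    exact ((mem_support_iff_stalkIdeal_le _ _).mp hsat) h1
  -- THE THREE JOINT LETTERS `(s, t₁, z')` and their pairs
  have hR : IsRsopPart ![s, t₁, z'] := hreg ht₁m hz'm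
  have hrs_sz : IsRsopPart ![s, z'] := isRsopPart_pair_of_triple hR ![0, 2] (by decide)
  have hrs_tz : IsRsopPart ![t₁, z'] := isRsopPart_pair_of_triple hR ![1, 2] (by decide)
  have hprime_z : (Ideal.span {z'}).IsPrime := isPrime_span_singleton_of_triple hR 2
  have hprime_t : (Ideal.span {t₁}).IsPrime := isPrime_span_singleton_of_triple hR 1
  have hsz' : s ∉ Ideal.span {z'} := head_not_mem_span_of_triple hR (j := 2) (by decide)
  have hst₁ : s ∉ Ideal.span {t₁} := head_not_mem_span_of_triple hR (j := 1) (by decide)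
  have hH' : stalkIdeal (strictTransformIdeal π C H) y = Ideal.span {z'} :=
    stalk_strictTransform_eq_span H y hHz hE hzz' hprime_z hsz'
  have hE' : stalkIdeal (strictTransformIdeal π C E) y = Ideal.span {t₁} :=
    stalk_strictTransform_eq_span E y hEt hE htt hprime_t hst₁
  -- transported principality: `𝓘'_y ⊆ (w₀) + (s^n)`
  have hpr' : stalkIdeal (controlledTransform π C I n) y ≤ Ideal.span {w₀} ⊔ Ideal.span {s ^ n} := by
    intro q hq
    rw [hI', Submodule.mem_colon_singleton, smul_eq_mul] at hq
    have h1 : q * s ^ n ∈ (Ideal.span {f} ⊔ maximalIdeal _ ^ (2 * n)).map σ := Ideal.map_mono hpr hq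
    rw [Ideal.map_sup, Ideal.map_span, Set.image_singleton, Ideal.map_pow, hEm, Ideal.span_singleton_pow] at h1
    obtain ⟨a₁, ha₁, a₂, ha₂, h12⟩ := Submodule.mem_sup.mp h1
    obtain ⟨α, rfl⟩ := Ideal.mem_span_singleton'.mp ha₁
    obtain ⟨β, rfl⟩ := Ideal.mem_span_singleton'.mp ha₂
    have h2 : s ^ n * q = s ^ n * (α * w₀ + β * s ^ n) := by
      calc s ^ n * q = q * s ^ n := by ring
        _ = α * σ f + β * s ^ (2 * n) := h12.symm
        _ = s ^ n * (α * w₀ + β * s ^ n) := by rw [← hw₀]; ring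
    rw [(mul_cancel_left_mem_nonZeroDivisors (pow_mem hnzd n)).mp h2]
    exact add_mem (Ideal.mem_sup_left (Ideal.mul_mem_left _ _ (Ideal.mem_span_singleton_self _)))
      (Ideal.mem_sup_right (Ideal.mul_mem_left _ _ (Ideal.mem_span_singleton_self _)))
  -- the no-jump witness along `(z')`: `f₁ = e·w₀ + k₂·s^n`
  obtain ⟨f₁, hf₁, c₁, hc₁, hf₁z⟩ := shapeAt_of_wInv h' z' hH'
  obtain ⟨a₁, ha₁, a₂, ha₂, h12⟩ := Submodule.mem_sup.mp (hpr' hf₁)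
  obtain ⟨e, rfl⟩ := Ideal.mem_span_singleton'.mp ha₁
  obtain ⟨k₂, rfl⟩ := Ideal.mem_span_singleton'.mp ha₂
  have hsn : s ^ n ∈ Ideal.span {s} := by
    rw [show n = (n - 1) + 1 by omega, pow_succ]
    exact Ideal.mul_mem_left _ _ (Ideal.mem_span_singleton_self s)
  have hz'nm : z' ^ n ∈ maximalIdeal _ ^ n := Ideal.pow_mem_pow hz'm n
  -- `e` is a unit (LEMMA Z on `(s, z')`)
  have heu : IsUnit e := by
    by_contra hne
    have hem : e ∈ maximalIdeal _ := (IsLocalRing.mem_maximalIdeal e).mpr (mem_nonunits_iff.mpr hne)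
    have h1 : c₁ * z' ^ n = e * w₀ + k₂ * s ^ n - (f₁ - c₁ * z' ^ n) := by rw [← h12]; ring
    have h2 : c₁ * z' ^ n ∈ Ideal.span {s} ⊔ maximalIdeal _ ^ (n + 1) := by
      rw [h1]
      refine sub_mem (add_mem (Ideal.mem_sup_right ?_) (Ideal.mem_sup_left (Ideal.mul_mem_left _ _ hsn)))
        (Ideal.mem_sup_right hf₁z)
      rw [pow_succ']
      exact Ideal.mul_mem_mul hem (hI'n hw₀I')
    have h3 := mem_maximalIdeal_of_rsopPair hrs_sz h2
    exact ((IsLocalRing.mem_maximalIdeal _).mp h3) hc₁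
  -- the units agree modulo `𝔪` (LEMMA Z on `(s, z')`)
  have hδ : (e * σ c - c₁) * z' ^ n ∈ Ideal.span {s} ⊔ maximalIdeal _ ^ (n + 1) := by
    have e1 : (e * σ c - c₁) * z' ^ n = (f₁ - c₁ * z' ^ n) - e * (s * t₁ * g₁) - k₂ * s ^ n := by
      rw [← hkey, ← h12]; ring
    rw [e1]
    refine sub_mem (sub_mem (Ideal.mem_sup_right hf₁z) (Ideal.mem_sup_left ?_))
      (Ideal.mem_sup_left (Ideal.mul_mem_left _ _ hsn))
    exact Ideal.mul_mem_left _ _ (Ideal.mul_mem_right _ _ (Ideal.mul_mem_right _ _ (Ideal.mem_span_singleton_self s)))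
  have hδm : e * σ c - c₁ ∈ maximalIdeal _ := mem_maximalIdeal_of_rsopPair hrs_sz hδ
  -- `k₂ ∈ 𝔪` (LEMMA Z₃ on `(s, t₁, z')`)
  have hk₂ : k₂ ∈ maximalIdeal (X'.presheaf.stalk y) := by
    refine mem_maximalIdeal_of_rsopTriple hR (n := n) ?_
    have e1 : k₂ * s ^ n = (f₁ - c₁ * z' ^ n) - e * (s * t₁ * g₁) - (e * σ c - c₁) * z' ^ n := by
      rw [← hkey, ← h12]; ring
    rw [e1]
    refine sub_mem (sub_mem (Ideal.mem_sup_right hf₁z) (Ideal.mem_sup_left ?_)) (Ideal.mem_sup_left ?_)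
    · exact Ideal.mul_mem_left _ _ (Ideal.mul_mem_right _ _
        (Ideal.mul_mem_left _ _ (Ideal.subset_span (Set.mem_insert _ _))))
    · exact Ideal.mul_mem_left _ _
        (Ideal.pow_mem_of_mem _ (Ideal.subset_span (Set.mem_insert_of_mem _ (Set.mem_singleton _))) n hn)
  -- hence the transported tail is DEEP: `s·t₁·g₁ ∈ 𝔪^{n+1}`
  have htail_m : s * t₁ * g₁ ∈ maximalIdeal (X'.presheaf.stalk y) ^ (n + 1) := by
    refine (Ideal.unit_mul_mem_iff_mem _ heu).mp ?_
    have e1 : e * (s * t₁ * g₁) = (f₁ - c₁ * z' ^ n) - (e * σ c - c₁) * z' ^ n - k₂ * s ^ n := by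
      rw [← hkey, ← h12]; ring
    rw [e1]
    refine sub_mem (sub_mem hf₁z ?_) ?_
    · rw [pow_succ']; exact Ideal.mul_mem_mul hδm hz'nm
    · rw [pow_succ']; exact Ideal.mul_mem_mul hk₂ (Ideal.pow_mem_pow hsm n)
  refine ⟨z', t₁, hH', hE', hrs_tz, w₀, hw₀I', σ c, hcu, ?_, ?_⟩
  · rw [hkey]
    exact Ideal.mul_mem_right _ _ (Ideal.mul_mem_left _ _ (Ideal.mem_span_singleton_self t₁))
  · rw [hkey]; exact htail_m

end HistoryTransport

end Summit.ResolutionOfSingularities.ResolutionOfSingularities.Theorems.HugValuationCut
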